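import Summits.QuantumFields.YangMills.Theorems.FluctuationComparisonRegPrIntLS2BetaChartReadDescentOnto
import HarnessLib

/-!
# S2β · THE CHAIN-RULE FORMULA FOR THE k-STEP CHART-READ (0.4) AVERAGE, EXPORTED: `DΨ_{k+1}(0) = Dψ_{Ū^k(U₀)}(0) ∘ DΨ_k(0)`, `DΨ_0(0) = id`, and the ray reading
# «`DΨ_k(0)` applied to a direction = `d∕dt` of the charted iterate along that line» (what the (RINV-curl) ∕ AVG₂♭ dischargers compute with)

Cell `ym3-torus` (YM ladder rung R3 = continuum `SU(2)` Yang–Mills on the three-torus at fixed lattice data — a RUNG: NOT d = 4, NOT infinite volume, NOT a mass gap,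
NOT Clay).  Width seat `ym3-torus-px13` (gen 25); crux `stmt-QuantumFields-20520` (`…Theses.UnitScaleTilt.FluctuationComparisonRegPrIntL`), LINE g18-1 S2β, organ GAP♯∘
⟸ (D♮) ∧ (F♮) ⟸ «CRIT♮» ⟸ «MULT♭» = CRIT-m♮ ∧ MULT♮ ∧ AVG₂♭.  ✓p823800 `…S2BetaChartReadDescentOnto` PINS `DM := fderiv ℝ Ψ_k 0` and proves it ONTO by an induction whose
step composes derivatives; MULT♮'s analytic half (px16 g21's letter (RINV-curl), bus 13:14:30Z) and AVG₂♭ (px10 g23) need the COMPOSITION FORMULA itself and the ray reading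
as citable statements.  THIS FILE exports them — `--kind proof --supports stmt-QuantumFields-20520 --as helper`, count-neutral, DEFINITION-FREE (0 `def`, 0 `instance`,
0 `notation`, 0 `sorry`).  Conventions of ✓p823800 verbatim (`Θ`∕`Λ` = `expChart`∕`logChart` of `isChartRep_specialUnitaryGroup (n := Fin N)`, `av i := blockAvg expMeanLogSU`,
`Ψ_k A c := Λ(Ū^k(Θ^B(A)·U₀)(c)·Ū^k(U₀)(c)⁻¹)`, `ψ_W` = N09's one-step chart-read average at base `W`).

WHAT IS PROVED (sorry-free; generic `P : Params`, `SU(N)`).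
* §1 ★★`hasFDerivAt_chartRead_iter_succ` ∕ ★★`fderiv_chartRead_iter_succ` — under the (0.4) guard below `k + 1` (`Node00.SmallBelow av (k+1) U₀`; NO numerics, NO standing range):
  **`fderiv ℝ Ψ_{k+1} 0 = (fderiv ℝ ψ_{Ū^k U₀} 0) ∘L (fderiv ℝ Ψ_k 0)`** (✓`chartRead_iter_succ_eventuallyEq` + `HasFDerivAt.comp` + ✓`contDiffAt_chartRead_iter`∕✓`contDiffAt_chartRead_avgFun`);
  `fderiv_chartRead_iter_succ_apply` (pointwise); `hasFDerivAt_chartRead_iter_zero'` ∕ `fderiv_chartRead_iter_zero` (**`fderiv ℝ Ψ_0 0 = id`**).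
* §2 ★`hasDerivAt_chartRead_iter_ray` — **`HasDerivAt (t ↦ Ψ_k (t • X)) (fderiv ℝ Ψ_k 0 X) 0`** (guard below `k`); `hasDerivAt_chartRead_avgFun_ray` (one step, N09's `ψ_{U₀}`).

HONEST.  Kernel calculus on the tree's own averaging (chain rule, ray derivative); NO estimate of Bałaban's; the VALUE of `Dψ_W(0)` on a direction (= the covariant linear average
up to `O(α)`, [Balaban1985Averaging] Prop. 3 (124)) is the sequel `…ChartReadDerivCovLinAvg`, NOT here; (RINV-curl), RINV-cov, MULT♮, AVG₂♭, CRIT-m♮'s assembly, «CRIT♮», (D♮)∕(F♮),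
GAP♯∘ (registry UNTOUCHED), the five REGISTERED stubs, S2β, crux 20520, 19936, 19200 and `YM3TorusSU2` are NOT proved; no summit statement is proved by a helper; rung R3 =
SU(2) YM₃ on T³ at fixed lattice data — NOT d = 4, NOT infinite volume, NOT a mass gap, NOT Clay; the Yang–Mills mass gap is NOT proved.  Axioms standard.

References: T. Bałaban, CMP **109** (1987) 249–301 [Balaban1987RG1] ((0.4), (0.8), (0.11) p.253: `Ū^k = M^k(U)`); CMP **98** (1985) 17–51 [Balaban1985Averaging] (Prop. 3
(121)–(124) p.36, Prop. 4 p.37: the linearised average and its iterate).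
-/

set_option autoImplicit false

noncomputable section

open scoped Matrix.Norms.L2Operator Topology
open Filter Set Function

namespace Summit.QuantumFields.YangMills.Theorems.FluctuationComparisonRegPrIntLS2BetaChartReadDescentChainRule

open Literature.MathematicalPhysics.QuantumFieldTheory.Balaban1983to89
open Literature.MathematicalPhysics.QuantumFieldTheory.Balaban1983to89.HaarExponentialChart
open Literature.MathematicalPhysics.QuantumFieldTheory.Balaban1983to89.HaarExponentialChart.IsChartRep
open Literature.MathematicalPhysics.QuantumFieldTheory.Balaban1983to89.BlockAveraging (Small Idx avgFun loopHol blockAvg blockAvg_avg)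
open Literature.MathematicalPhysics.QuantumFieldTheory.Balaban1983to89.ExpMeanLog (expMeanLogSU deltaSU)
open Literature.MathematicalPhysics.QuantumFieldTheory.Balaban1983to89.Node00
open Summit.QuantumFields.YangMills.BalabanUVNodes.N09ChartReadAveragingSmooth
open Summit.QuantumFields.YangMills.Theorems.FluctuationComparisonRegPrIntLS2BetaChartReadDescentOnto

variable {P : Params} {N : ℕ} [NeZero N]

/-! ## §1 The composition formula -/

section Chain

/-- ★★ **THE CHAIN RULE, `HasFDerivAt` FORM**: under the (0.4) guard below `k + 1`, `Ψ_{k+1}` has derivative `Dψ_{Ū^k U₀}(0) ∘ DΨ_k(0)` at `0`.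
[cite: Balaban1987RG1, (0.11) p.253; Balaban1985Averaging, Prop. 4 p.37] -/
theorem hasFDerivAt_chartRead_iter_succ (U₀ : GaugeField P 0 (SU N)) (k : ℕ)
    (hsb : SmallBelow (fun i => blockAvg (P := P) (j := i) (expMeanLogSU (n := Fin N))) (k + 1) U₀) :
    HasFDerivAt (fun (A : PBond P 0 → (specialUnitaryLogChart (Fin N)).lie) (c' : PBond P (k + 1)) =>
        (isChartRep_specialUnitaryGroup (n := Fin N)).logChart
          (Averaging.iter (fun i => blockAvg (P := P) (j := i) (expMeanLogSU (n := Fin N))) (k + 1)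
              (fun b => (isChartRep_specialUnitaryGroup (n := Fin N)).expChart (A b) * U₀ b) c' *
            (Averaging.iter (fun i => blockAvg (P := P) (j := i) (expMeanLogSU (n := Fin N))) (k + 1) U₀ c')⁻¹))
      ((fderiv ℝ (fun (B : PBond P k → (specialUnitaryLogChart (Fin N)).lie) (c' : PBond P (k + 1)) =>
          (isChartRep_specialUnitaryGroup (n := Fin N)).logChart
            (avgFun (expMeanLogSU (n := Fin N))
                (fun c => (isChartRep_specialUnitaryGroup (n := Fin N)).expChart (B c) *
                  Averaging.iter (fun i => blockAvg (P := P) (j := i) (expMeanLogSU (n := Fin N))) k U₀ c) c' *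
              (avgFun (expMeanLogSU (n := Fin N)) (Averaging.iter (fun i => blockAvg (P := P) (j := i) (expMeanLogSU (n := Fin N))) k U₀) c')⁻¹)) 0).comp
        (fderiv ℝ (fun (A : PBond P 0 → (specialUnitaryLogChart (Fin N)).lie) (c : PBond P k) =>
          (isChartRep_specialUnitaryGroup (n := Fin N)).logChart
            (Averaging.iter (fun i => blockAvg (P := P) (j := i) (expMeanLogSU (n := Fin N))) k
                (fun b => (isChartRep_specialUnitaryGroup (n := Fin N)).expChart (A b) * U₀ b) c *
              (Averaging.iter (fun i => blockAvg (P := P) (j := i) (expMeanLogSU (n := Fin N))) k U₀ c)⁻¹)) 0)) 0 := by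
  set Uk : GaugeField P k (SU N) := Averaging.iter (fun i => blockAvg (P := P) (j := i) (expMeanLogSU (n := Fin N))) k U₀ with hUk
  set Ψk := fun (A : PBond P 0 → (specialUnitaryLogChart (Fin N)).lie) (c : PBond P k) =>
      (isChartRep_specialUnitaryGroup (n := Fin N)).logChart
        (Averaging.iter (fun i => blockAvg (P := P) (j := i) (expMeanLogSU (n := Fin N))) k
            (fun b => (isChartRep_specialUnitaryGroup (n := Fin N)).expChart (A b) * U₀ b) c *
          (Averaging.iter (fun i => blockAvg (P := P) (j := i) (expMeanLogSU (n := Fin N))) k U₀ c)⁻¹) with hΨk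
  set ψ := fun (B : PBond P k → (specialUnitaryLogChart (Fin N)).lie) (c' : PBond P (k + 1)) =>
      (isChartRep_specialUnitaryGroup (n := Fin N)).logChart
        (avgFun (expMeanLogSU (n := Fin N)) (fun c => (isChartRep_specialUnitaryGroup (n := Fin N)).expChart (B c) * Uk c) c' *
          (avgFun (expMeanLogSU (n := Fin N)) Uk c')⁻¹) with hψ
  have hΨkC : ContDiffAt ℝ ⊤ Ψk 0 := contDiffAt_chartRead_iter (P := P) (N := N) U₀ k (hsb.mono (Nat.le_succ k))
  have hψC : ContDiffAt ℝ ⊤ ψ 0 := contDiffAt_chartRead_avgFun (P := P) (j := k) Uk (fun c => hsb k (Nat.lt_succ_self k) c)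
  have hfac := chartRead_iter_succ_eventuallyEq (P := P) (N := N) U₀ k (hsb.mono (Nat.le_succ k))
  have hΨk0 : Ψk 0 = 0 := chartRead_iter_apply_zero (P := P) (N := N) U₀ k
  have hΨkD : HasFDerivAt Ψk (fderiv ℝ Ψk 0) 0 := (hΨkC.differentiableAt (by simp)).hasFDerivAt
  have hψD : HasFDerivAt ψ (fderiv ℝ ψ 0) (Ψk 0) := by rw [hΨk0]; exact (hψC.differentiableAt (by simp)).hasFDerivAt
  have hcomp : HasFDerivAt (ψ ∘ Ψk) ((fderiv ℝ ψ 0).comp (fderiv ℝ Ψk 0)) 0 :=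
    HasFDerivAt.comp (𝕜 := ℝ) (f := Ψk) (f' := fderiv ℝ Ψk 0) (g := ψ) (g' := fderiv ℝ ψ 0)
      (0 : PBond P 0 → (specialUnitaryLogChart (Fin N)).lie) hψD hΨkD
  exact hcomp.congr_of_eventuallyEq hfac

/-- ★★ **THE CHAIN-RULE FORMULA**: `fderiv ℝ Ψ_{k+1} 0 = (fderiv ℝ ψ_{Ū^k U₀} 0) ∘L (fderiv ℝ Ψ_k 0)` under the (0.4) guard below `k + 1`.
[cite: Balaban1987RG1, (0.11) p.253; Balaban1985Averaging, Prop. 4 p.37] -/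
theorem fderiv_chartRead_iter_succ (U₀ : GaugeField P 0 (SU N)) (k : ℕ)
    (hsb : SmallBelow (fun i => blockAvg (P := P) (j := i) (expMeanLogSU (n := Fin N))) (k + 1) U₀) :
    fderiv ℝ (fun (A : PBond P 0 → (specialUnitaryLogChart (Fin N)).lie) (c' : PBond P (k + 1)) =>
        (isChartRep_specialUnitaryGroup (n := Fin N)).logChart
          (Averaging.iter (fun i => blockAvg (P := P) (j := i) (expMeanLogSU (n := Fin N))) (k + 1)
              (fun b => (isChartRep_specialUnitaryGroup (n := Fin N)).expChart (A b) * U₀ b) c' *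
            (Averaging.iter (fun i => blockAvg (P := P) (j := i) (expMeanLogSU (n := Fin N))) (k + 1) U₀ c')⁻¹)) 0 =
      (fderiv ℝ (fun (B : PBond P k → (specialUnitaryLogChart (Fin N)).lie) (c' : PBond P (k + 1)) =>
          (isChartRep_specialUnitaryGroup (n := Fin N)).logChart
            (avgFun (expMeanLogSU (n := Fin N))
                (fun c => (isChartRep_specialUnitaryGroup (n := Fin N)).expChart (B c) *
                  Averaging.iter (fun i => blockAvg (P := P) (j := i) (expMeanLogSU (n := Fin N))) k U₀ c) c' *
              (avgFun (expMeanLogSU (n := Fin N)) (Averaging.iter (fun i => blockAvg (P := P) (j := i) (expMeanLogSU (n := Fin N))) k U₀) c')⁻¹)) 0).comp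
        (fderiv ℝ (fun (A : PBond P 0 → (specialUnitaryLogChart (Fin N)).lie) (c : PBond P k) =>
          (isChartRep_specialUnitaryGroup (n := Fin N)).logChart
            (Averaging.iter (fun i => blockAvg (P := P) (j := i) (expMeanLogSU (n := Fin N))) k
                (fun b => (isChartRep_specialUnitaryGroup (n := Fin N)).expChart (A b) * U₀ b) c *
              (Averaging.iter (fun i => blockAvg (P := P) (j := i) (expMeanLogSU (n := Fin N))) k U₀ c)⁻¹)) 0) :=
  (hasFDerivAt_chartRead_iter_succ (P := P) (N := N) U₀ k hsb).fderiv

/-- Pointwise: `DΨ_{k+1}(0) A = Dψ_{Ū^k U₀}(0) (DΨ_k(0) A)`. [cite: Balaban1987RG1, (0.11) p.253; Balaban1985Averaging, Prop. 4 p.37] -/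
theorem fderiv_chartRead_iter_succ_apply (U₀ : GaugeField P 0 (SU N)) (k : ℕ)
    (hsb : SmallBelow (fun i => blockAvg (P := P) (j := i) (expMeanLogSU (n := Fin N))) (k + 1) U₀)
    (A : PBond P 0 → (specialUnitaryLogChart (Fin N)).lie) :
    fderiv ℝ (fun (A : PBond P 0 → (specialUnitaryLogChart (Fin N)).lie) (c' : PBond P (k + 1)) =>
        (isChartRep_specialUnitaryGroup (n := Fin N)).logChart
          (Averaging.iter (fun i => blockAvg (P := P) (j := i) (expMeanLogSU (n := Fin N))) (k + 1)
              (fun b => (isChartRep_specialUnitaryGroup (n := Fin N)).expChart (A b) * U₀ b) c' *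
            (Averaging.iter (fun i => blockAvg (P := P) (j := i) (expMeanLogSU (n := Fin N))) (k + 1) U₀ c')⁻¹)) 0 A =
      fderiv ℝ (fun (B : PBond P k → (specialUnitaryLogChart (Fin N)).lie) (c' : PBond P (k + 1)) =>
          (isChartRep_specialUnitaryGroup (n := Fin N)).logChart
            (avgFun (expMeanLogSU (n := Fin N))
                (fun c => (isChartRep_specialUnitaryGroup (n := Fin N)).expChart (B c) *
                  Averaging.iter (fun i => blockAvg (P := P) (j := i) (expMeanLogSU (n := Fin N))) k U₀ c) c' *
              (avgFun (expMeanLogSU (n := Fin N)) (Averaging.iter (fun i => blockAvg (P := P) (j := i) (expMeanLogSU (n := Fin N))) k U₀) c')⁻¹)) 0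
        (fderiv ℝ (fun (A : PBond P 0 → (specialUnitaryLogChart (Fin N)).lie) (c : PBond P k) =>
          (isChartRep_specialUnitaryGroup (n := Fin N)).logChart
            (Averaging.iter (fun i => blockAvg (P := P) (j := i) (expMeanLogSU (n := Fin N))) k
                (fun b => (isChartRep_specialUnitaryGroup (n := Fin N)).expChart (A b) * U₀ b) c *
              (Averaging.iter (fun i => blockAvg (P := P) (j := i) (expMeanLogSU (n := Fin N))) k U₀ c)⁻¹)) 0 A) := by
  rw [fderiv_chartRead_iter_succ (P := P) (N := N) U₀ k hsb, ContinuousLinearMap.comp_apply]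

/-- **STEP ZERO**: `Ψ_0` has derivative `id` at `0` (it IS `id` near `0`, ✓`chartRead_iter_zero_eventuallyEq`). [cite: Helgason2000, Ch. I §1 Thm. 1.14 (13) p. 96 (bookkeeping)] -/
theorem hasFDerivAt_chartRead_iter_zero' (U₀ : GaugeField P 0 (SU N)) :
    HasFDerivAt (fun (A : PBond P 0 → (specialUnitaryLogChart (Fin N)).lie) (c : PBond P 0) =>
        (isChartRep_specialUnitaryGroup (n := Fin N)).logChart
          (Averaging.iter (fun i => blockAvg (P := P) (j := i) (expMeanLogSU (n := Fin N))) 0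
              (fun b => (isChartRep_specialUnitaryGroup (n := Fin N)).expChart (A b) * U₀ b) c *
            (Averaging.iter (fun i => blockAvg (P := P) (j := i) (expMeanLogSU (n := Fin N))) 0 U₀ c)⁻¹))
      (ContinuousLinearMap.id ℝ (PBond P 0 → (specialUnitaryLogChart (Fin N)).lie)) 0 :=
  (hasFDerivAt_id (𝕜 := ℝ) (0 : PBond P 0 → (specialUnitaryLogChart (Fin N)).lie)).congr_of_eventuallyEq
    (chartRead_iter_zero_eventuallyEq (P := P) (N := N) U₀)

/-- `fderiv ℝ Ψ_0 0 = id`. [cite: Helgason2000, Ch. I §1 Thm. 1.14 (13) p. 96 (bookkeeping)] -/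
theorem fderiv_chartRead_iter_zero (U₀ : GaugeField P 0 (SU N)) :
    fderiv ℝ (fun (A : PBond P 0 → (specialUnitaryLogChart (Fin N)).lie) (c : PBond P 0) =>
        (isChartRep_specialUnitaryGroup (n := Fin N)).logChart
          (Averaging.iter (fun i => blockAvg (P := P) (j := i) (expMeanLogSU (n := Fin N))) 0
              (fun b => (isChartRep_specialUnitaryGroup (n := Fin N)).expChart (A b) * U₀ b) c *
            (Averaging.iter (fun i => blockAvg (P := P) (j := i) (expMeanLogSU (n := Fin N))) 0 U₀ c)⁻¹)) 0 =
      ContinuousLinearMap.id ℝ (PBond P 0 → (specialUnitaryLogChart (Fin N)).lie) :=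
  (hasFDerivAt_chartRead_iter_zero' (P := P) (N := N) U₀).fderiv

end Chain

/-! ## §2 The ray reading: `DΨ_k(0) X = d∕dt Ψ_k(t·X)|₀` -/

section Ray

/-- ★ **`DΨ_k(0)` ON A DIRECTION IS THE `t`-DERIVATIVE OF THE CHARTED ITERATE ALONG THE LINE `t ↦ t·X`** (guard below `k`; ✓N09 `hasDerivAt_along_ray` with
✓`contDiffAt_chartRead_iter`). [cite: Balaban1987RG1, (0.11) p.253; Balaban1985Averaging, Prop. 4 p.37] -/
theorem hasDerivAt_chartRead_iter_ray (U₀ : GaugeField P 0 (SU N)) (k : ℕ)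
    (hsb : SmallBelow (fun i => blockAvg (P := P) (j := i) (expMeanLogSU (n := Fin N))) k U₀)
    (X : PBond P 0 → (specialUnitaryLogChart (Fin N)).lie) :
    HasDerivAt (fun t : ℝ => (fun (A : PBond P 0 → (specialUnitaryLogChart (Fin N)).lie) (c : PBond P k) =>
        (isChartRep_specialUnitaryGroup (n := Fin N)).logChart
          (Averaging.iter (fun i => blockAvg (P := P) (j := i) (expMeanLogSU (n := Fin N))) k
              (fun b => (isChartRep_specialUnitaryGroup (n := Fin N)).expChart (A b) * U₀ b) c *
            (Averaging.iter (fun i => blockAvg (P := P) (j := i) (expMeanLogSU (n := Fin N))) k U₀ c)⁻¹)) (t • X))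
      (fderiv ℝ (fun (A : PBond P 0 → (specialUnitaryLogChart (Fin N)).lie) (c : PBond P k) =>
        (isChartRep_specialUnitaryGroup (n := Fin N)).logChart
          (Averaging.iter (fun i => blockAvg (P := P) (j := i) (expMeanLogSU (n := Fin N))) k
              (fun b => (isChartRep_specialUnitaryGroup (n := Fin N)).expChart (A b) * U₀ b) c *
            (Averaging.iter (fun i => blockAvg (P := P) (j := i) (expMeanLogSU (n := Fin N))) k U₀ c)⁻¹)) 0 X) 0 :=
  hasDerivAt_along_ray ((contDiffAt_chartRead_iter (P := P) (N := N) U₀ k hsb).differentiableAt (by simp)) X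

/-- The one-step case (N09's `ψ_{U₀}` at level `j`): `HasDerivAt (t ↦ ψ_{U₀}(t·X)) (Dψ_{U₀}(0) X) 0` under the guard at `U₀`.
[cite: Balaban1987RG1, (0.4) p.253; Balaban1985Averaging, Prop. 3 (121)-(124) p.36] -/
theorem hasDerivAt_chartRead_avgFun_ray {j : ℕ} (U₀ : GaugeField P j (SU N)) (hsmall : ∀ c, Small (expMeanLogSU (n := Fin N)) U₀ c)
    (X : PBond P j → (specialUnitaryLogChart (Fin N)).lie) :
    HasDerivAt (fun t : ℝ => (fun (A : PBond P j → (specialUnitaryLogChart (Fin N)).lie) (c : PBond P (j + 1)) =>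
        (isChartRep_specialUnitaryGroup (n := Fin N)).logChart
          (avgFun (expMeanLogSU (n := Fin N)) (fun b => (isChartRep_specialUnitaryGroup (n := Fin N)).expChart (A b) * U₀ b) c *
            (avgFun (expMeanLogSU (n := Fin N)) U₀ c)⁻¹)) (t • X))
      (fderiv ℝ (fun (A : PBond P j → (specialUnitaryLogChart (Fin N)).lie) (c : PBond P (j + 1)) =>
        (isChartRep_specialUnitaryGroup (n := Fin N)).logChart
          (avgFun (expMeanLogSU (n := Fin N)) (fun b => (isChartRep_specialUnitaryGroup (n := Fin N)).expChart (A b) * U₀ b) c *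
            (avgFun (expMeanLogSU (n := Fin N)) U₀ c)⁻¹)) 0 X) 0 :=
  hasDerivAt_along_ray ((contDiffAt_chartRead_avgFun (P := P) (j := j) U₀ hsmall).differentiableAt (by simp)) X

end Ray

end Summit.QuantumFields.YangMills.Theorems.FluctuationComparisonRegPrIntLS2BetaChartReadDescentChainRule

end
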